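import Summits.RiemannHypothesis.RiemannHypothesis.Theorems.Splittings.LiOneSidedCriteriaCore
import HarnessLib

/-!
# Splittings — Li bridge lens, ONE-SIDED SUB-EXPONENTIAL ENVELOPES of `λ_n`, part 2/4: the twisted Li lemma with
# one-sided floors, the `φ`-specific inputs, a zero of least modulus, resonance — SPLIT-li-bridge gen 4

Cell rh-split, seat rh-split-li-bridge g4 (brief sha16 f79c5f09d8bcb036), card
`run/shared/lean/pub/rh-split/cards/SPLIT-li-bridge.md` §11; zero-definition raw form of
`HOME/rh-split-li-bridge/SketchG4.lean` (sha16 00b14b55d9ac9472; referee rh-split-ref g2 verdict 2026-08-27T03:19:00Z: §11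
DELIVERABLE, farm rc 0 / 0 warn / 0 sorry, std axioms on `rh_iff_liSubexpUpper`, `rh_iff_liCesaroBddBelow`; CONTENT PRE-FILE
PASS «LiOneSidedCriteria{,Cesaro} zero-def carve (§11.3 excluded)»), filed by rh-split-typer-1 g4 in four parts
(`LiOneSidedCriteriaCore`, `LiOneSidedCriteriaTwist`, `LiOneSidedCriteria`, `LiOneSidedCriteriaCesaro`; the 400-line rule).
NOT CARRIED (card §11.3 = the scratch's file-§§8–9 progression rows, CONDITIONAL BOOKKEEPING on unprinted non-resonance):
the two defs `LiProgFloor` / `LiProgNonResonance` and `rh_of_nonResonance_progFloor`, `nonResonance_one`,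
`liPhi_ne_zero_of_rh` (tree: `Literature.NumberTheory.LFunctions.liPhi_ne_zero_of_rh`), `nonResonance_of_rh`,
`rh_iff_nonResonance_and_progFloor`.  The RH-free lemma `resonance_of_progFloor` is kept with `LiProgFloor σ q a` SPELLED OUT
(it is the engine of the `q = 1` criteria), and `rh_of_liFloor` is re-routed through it at `q = 1` (the scratch went through
`rh_of_nonResonance_progFloor` + `nonResonance_one`; same argument, `Finset.range 1` has no `j ≠ 0`).  Proofs otherwise verbatim;
docstrings added where the scratch had none.
HONEST LABEL: «SPLITTING SEARCH over kernel-typed RH-EQUIVALENCES; a splitting A ∧ B ⟹ RH is CONDITIONAL bookkeeping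
unless A and B are both proved; nothing here bears on the truth of RH.»  Every theorem below is an RH-EQUIVALENCE (neither side
asserted) or an RH-FREE implication whose hypothesis is of RH strength; `Summit.RiemannHypothesis` appears only as a
conclusion of such implications or as a hypothesis.

This part:
* §4 the abstract twisted Li lemma, FLOOR version (`twisted_core`): as g3's `twisted_li_core`, with «coefficients eventually
  real and `≥ 0`» replaced by «eventually real with `σ·c_n ≥ -d_n`», `Σ d_n r₀ⁿ < ∞`, `σ = ±1`;
* §5 arithmetic of the progression (`prog_index`); §6 the `φ`-specific inputs (`exists_log_liPhi`, `iteratedDeriv_log_eq`,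
  `taylorCoeff_eq` — `λ_n/n` as the `n`-th Taylor coefficient of any logarithm of `φ` —, `coeff_real_floor`);
* §7 a zero of LEAST modulus from any zero of `φ` in the unit disc (`exists_least_zero`); `φ(r) ≠ 0` for real `r ∈ [0,1)` —
  the structural input `ξ > 0` on `(1, ∞)` (`riemannXi_ofReal_pos`) that makes the UPPER side work for `ζ`
  (`liPhi_ofReal_ne_zero`); the geometric rate (`exp_eps_mul_lt_one`, `summable_slack`); and **resonance from a floor**
  (`resonance_of_progFloor`, the scratch's `LiProgFloor σ q a` SPELLED OUT): a one-sided sub-exponential floor for `σ λ`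
  along `qℕ + a` and a zero of `φ` in the disc force a least-modulus zero `z₀` and a rotation `ζ_q^j` (`j ≠ 0`) carrying
  `z₀` or `|z₀|` onto another zero of `φ`.  RH-free throughout.
-/

set_option linter.dupNamespace false

noncomputable section

open Complex Filter Topology Finset
open scoped Nat Real ComplexOrder ComplexConjugate

namespace Summit.RiemannHypothesis.RiemannHypothesis.Theorems.Splittings.LiOneSidedCriteria

open Literature.NumberTheory.LFunctions
open Summit.RiemannHypothesis.RiemannHypothesis.Theorems.Splittings
open Summit.RiemannHypothesis.RiemannHypothesis.Theorems.Splittings.LiProgression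

/-! ## 4. The abstract twisted Li lemma with one-sided sub-exponential floors -/

/-- Summability of the slack series at smaller radius, and comparison of the sums. -/
theorem slack_le {d : ℕ → ℝ} (hd : ∀ n, 0 ≤ d n) {r₀ : ℝ} (hdsum : Summable fun n ↦ d n * r₀ ^ n)
    {s : ℝ} (hs0 : 0 ≤ s) (hs : s ≤ r₀) :
    Summable (fun n ↦ d n * s ^ n) ∧ ∑' n, d n * s ^ n ≤ ∑' n, d n * r₀ ^ n := by
  have hle : ∀ n, d n * s ^ n ≤ d n * r₀ ^ n := fun n ↦
    mul_le_mul_of_nonneg_left (pow_le_pow_left₀ hs0 hs n) (hd n)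
  have hnn : ∀ n, 0 ≤ d n * s ^ n := fun n ↦ mul_nonneg (hd n) (pow_nonneg hs0 _)
  have hsum : Summable (fun n ↦ d n * s ^ n) := hdsum.of_nonneg_of_le hnn hle
  exact ⟨hsum, hsum.tsum_le_tsum hle hdsum⟩

/-- **Twisted Li lemma, floor version.** As g3's `twisted_li_core`, with «coefficients eventually real and
`≥ 0`» replaced by «eventually real with `σ·c_n ≥ -d_n`», `Σ d_n r₀ⁿ < ∞`, `σ = ±1`. -/
theorem twisted_core {f ℓ : ℂ → ℂ} {q b N₀ : ℕ} (hq : q ≠ 0) {r₀ : ℝ} (hr₀ : 0 < r₀)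
    (hr₁ : r₀ < 1) (hf : DifferentiableOn ℂ f (Metric.ball 0 1))
    (hfree : ∀ z ∈ Metric.ball (0 : ℂ) r₀, f z ≠ 0)
    {z₀ : ℂ} (hz₀ : ‖z₀‖ = r₀) (hfz₀ : f z₀ = 0)
    (hℓ : DifferentiableOn ℂ ℓ (Metric.ball 0 r₀))
    (hfl : ∀ z ∈ Metric.ball (0 : ℂ) r₀, f z = exp (ℓ z))
    {c : ℕ → ℂ}
    (hc : ∀ w ∈ Metric.ball (0 : ℂ) r₀, HasSum (fun n ↦ c n * w ^ n)
      (∑ j ∈ Finset.range q, (exp (2 * π * I / q) ^ j) ^ b * ℓ (exp (2 * π * I / q) ^ j * w)))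
    {d : ℕ → ℝ} (hd : ∀ n, 0 ≤ d n) (hdsum : Summable fun n ↦ d n * r₀ ^ n)
    {σ : ℝ} (hσ : σ = 1 ∨ σ = -1)
    (hpos : ∀ n, N₀ ≤ n → (c n).im = 0 ∧ -d n ≤ σ * (c n).re)
    (hR1 : ∀ j ∈ Finset.range q, f (exp (2 * π * I / q) ^ j * r₀) ≠ 0)
    (hR2 : ∀ j ∈ Finset.range q, j ≠ 0 → f (exp (2 * π * I / q) ^ j * z₀) ≠ 0) : False := by
  set ζ : ℂ := exp (2 * π * I / q) with hζdef
  have hζn : ∀ j : ℕ, ‖ζ ^ j‖ = 1 := norm_rootOfUnity_pow hq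
  have hsb : ∀ p : ℂ, ‖p‖ = r₀ → f p ≠ 0 → ∃ M : ℝ, ∀ u ∈ Set.Ico (0 : ℝ) 1, ‖ℓ (u * p)‖ ≤ M :=
    fun p hp hfp ↦ segment_bound hr₀ hr₁ hf hℓ hfl hp hfp
  choose! M hM using hsb
  have h0q : 0 ∈ Finset.range q := Finset.mem_range.2 (Nat.pos_of_ne_zero hq)
  set D₀ : ℝ := ∑' n, d n * r₀ ^ n with hD₀
  refine endgame hr₀ hr₁ hf hfree hz₀ hfz₀
    (D := 2 * ∑ n ∈ Finset.range N₀, ‖c n‖ + 2 * D₀ + ∑ j ∈ Finset.range q, M (ζ ^ j * r₀)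
        + ∑ j ∈ (Finset.range q).erase 0, M (ζ ^ j * z₀)) fun u hu ↦ ?_
  obtain ⟨hu0, hu1⟩ := hu
  set w : ℂ := u * z₀ with hw
  have hwn : ‖w‖ = u * r₀ := by
    rw [hw, norm_mul, Complex.norm_real, Real.norm_eq_abs, abs_of_nonneg hu0, hz₀]
  have hwr : ‖w‖ < r₀ := by rw [hwn]; nlinarith
  have hwball : w ∈ Metric.ball (0 : ℂ) r₀ := by rwa [Metric.mem_ball, dist_zero_right]
  have hwball' : ((‖w‖ : ℝ) : ℂ) ∈ Metric.ball (0 : ℂ) r₀ := by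
    rw [Metric.mem_ball, dist_zero_right, Complex.norm_real, Real.norm_eq_abs, abs_norm]
    exact hwr
  have hw1 : ‖w‖ ≤ 1 := by linarith
  -- (i) domination
  obtain ⟨hdw, hDw⟩ := slack_le hd hdsum (norm_nonneg w) hwr.le
  have hdom := norm_le_of_hasSum hσ hd hpos hw1 (hc w hwball) (hc _ hwball') hdw.hasSum
  -- (ii) the real point
  have hii : σ * (∑ j ∈ Finset.range q, (ζ ^ j) ^ b * ℓ (ζ ^ j * ((‖w‖ : ℝ) : ℂ))).re
      ≤ ∑ j ∈ Finset.range q, M (ζ ^ j * r₀) := by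
    have hB : σ * (∑ j ∈ Finset.range q, (ζ ^ j) ^ b * ℓ (ζ ^ j * ((‖w‖ : ℝ) : ℂ))).re
        ≤ ‖∑ j ∈ Finset.range q, (ζ ^ j) ^ b * ℓ (ζ ^ j * ((‖w‖ : ℝ) : ℂ))‖ := by
      have h := Complex.abs_re_le_norm (∑ j ∈ Finset.range q, (ζ ^ j) ^ b * ℓ (ζ ^ j * ((‖w‖ : ℝ) : ℂ)))
      rcases hσ with rfl | rfl
      · rw [one_mul]; exact (le_abs_self _).trans h
      · rw [neg_one_mul]; exact (neg_le_abs _).trans h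
    refine hB.trans ((norm_sum_le _ _).trans (Finset.sum_le_sum fun j hj ↦ ?_))
    rw [norm_mul, norm_pow, hζn, one_pow, one_mul, hwn,
      show ζ ^ j * (((u * r₀ : ℝ)) : ℂ) = ((u : ℝ) : ℂ) * (ζ ^ j * (r₀ : ℂ)) by push_cast; ring]
    exact hM _ (by rw [norm_mul, hζn, one_mul, Complex.norm_real, Real.norm_eq_abs,
      abs_of_pos hr₀]) (hR1 j hj) u ⟨hu0, hu1⟩
  -- (iii) the point `w`: the `j = 0` term is `log |f w|`
  have hiii : (∑ j ∈ Finset.range q, (ζ ^ j) ^ b * ℓ (ζ ^ j * w)).re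
      ≤ Real.log ‖f w‖ + ∑ j ∈ (Finset.range q).erase 0, M (ζ ^ j * z₀) := by
    rw [← Finset.add_sum_erase _ _ h0q, Complex.add_re, pow_zero, one_pow, one_mul, one_mul]
    refine add_le_add (le_of_eq ?_) ((Complex.re_le_norm _).trans ((norm_sum_le _ _).trans
      (Finset.sum_le_sum fun j hj ↦ ?_)))
    · rw [hfl w hwball, Complex.norm_exp, Real.log_exp]
    · obtain ⟨hj0, hjq⟩ := Finset.mem_erase.1 hj
      rw [norm_mul, norm_pow, hζn, one_pow, one_mul, hw, mul_left_comm]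
      exact hM _ (by rw [norm_mul, hζn, one_mul, hz₀]) (hR2 j hjq hj0) u ⟨hu0, hu1⟩
  have hre : -‖∑ j ∈ Finset.range q, (ζ ^ j) ^ b * ℓ (ζ ^ j * w)‖
      ≤ (∑ j ∈ Finset.range q, (ζ ^ j) ^ b * ℓ (ζ ^ j * w)).re :=
    (abs_le.1 (Complex.abs_re_le_norm _)).1
  linarith [hdom, hii, hiii, hre, hDw]

/-! ## 5. Arithmetic of the progression (g3 §5) -/

/-- Index arithmetic of the progression: `q ∣ a + b`, `q ∣ n + b`, `qk₀ + a ≤ n` give `n = qk + a` with `k ≥ k₀`. -/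
theorem prog_index {q a b n k₀ : ℕ} (hq : 0 < q) (hab : q ∣ a + b) (hn : q ∣ n + b)
    (hN : q * k₀ + a ≤ n) : ∃ k, k₀ ≤ k ∧ n = q * k + a := by
  have han : a ≤ n := le_trans (Nat.le_add_left a (q * k₀)) hN
  have hd : q ∣ (n + b) - (a + b) := Nat.dvd_sub hn hab
  rw [Nat.add_sub_add_right] at hd
  obtain ⟨k, hk⟩ := hd
  refine ⟨k, ?_, by omega⟩
  have : q * k₀ ≤ q * k := by omega
  exact Nat.le_of_mul_le_mul_left this hq

/-! ## 6. `φ`-specific inputs (g3 §6, floor version of the coefficient lemma) -/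

/-- A holomorphic logarithm of Li's `φ` on any zero-free disc `|z| < r₀ ≤ 1` (`Complex.exists_eq_exp_of_forall_isExactOn`
on the convex ball). -/
theorem exists_log_liPhi {r₀ : ℝ} (hr₁ : r₀ ≤ 1)
    (hfree : ∀ z ∈ Metric.ball (0 : ℂ) r₀, liPhi z ≠ 0) :
    ∃ ℓ : ℂ → ℂ, DifferentiableOn ℂ ℓ (Metric.ball 0 r₀) ∧
      ∀ z ∈ Metric.ball (0 : ℂ) r₀, liPhi z = exp (ℓ z) :=
  Complex.exists_eq_exp_of_forall_isExactOn Metric.isOpen_ball (convex_ball (0 : ℂ) r₀).isPreconnected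
    (fun _ hf ↦ hf.isExactOn_ball) (differentiableOn_liPhi.mono (Metric.ball_subset_ball hr₁)) hfree

/-- The Taylor coefficients of ANY logarithm `ℓ` of `φ` on `|z| < r₀` are Keiper's: `ℓ⁽ⁿ⁾(0) = (n-1)!·λ_n` (`n ≥ 1`;
tree `iteratedDeriv_log_liPhi_zero_eq` + `iteratedDeriv_eq_of_exp_eq`). -/
theorem iteratedDeriv_log_eq {r₀ : ℝ} (hr₀ : 0 < r₀) {ℓ : ℂ → ℂ}
    (hℓ : DifferentiableOn ℂ ℓ (Metric.ball 0 r₀))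
    (hfl : ∀ z ∈ Metric.ball (0 : ℂ) r₀, liPhi z = exp (ℓ z)) {n : ℕ} (hn : 1 ≤ n) :
    iteratedDeriv n ℓ 0 = ((((n - 1)! : ℝ) * keiperLiCoeff n : ℝ) : ℂ) := by
  rw [← iteratedDeriv_log_liPhi_zero_eq n]
  refine iteratedDeriv_eq_of_exp_eq (f := liPhi) ?_ analyticAt_log_liPhi_zero ?_ ?_ hn
  · exact hℓ.analyticAt (Metric.ball_mem_nhds 0 hr₀)
  · exact Filter.eventually_of_mem (Metric.ball_mem_nhds 0 hr₀) hfl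
  · filter_upwards [eventually_liPhi_mem_slitPlane] with z hz
    exact (Complex.exp_log (Complex.slitPlane_ne_zero hz)).symm

/-- `λ_n / n` as the `n`-th Taylor coefficient of `ℓ`. -/
theorem taylorCoeff_eq {r₀ : ℝ} (hr₀ : 0 < r₀) {ℓ : ℂ → ℂ}
    (hℓ : DifferentiableOn ℂ ℓ (Metric.ball 0 r₀))
    (hfl : ∀ z ∈ Metric.ball (0 : ℂ) r₀, liPhi z = exp (ℓ z)) {n : ℕ} (hn : 1 ≤ n) :
    (n ! : ℂ)⁻¹ * iteratedDeriv n ℓ 0 = ((keiperLiCoeff n / n : ℝ) : ℂ) := by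
  rw [iteratedDeriv_log_eq hr₀ hℓ hfl hn]
  have hfac : (n ! : ℝ) = n * ((n - 1)! : ℝ) := by
    exact_mod_cast (Nat.mul_factorial_pred (by omega : n ≠ 0)).symm
  have hn0 : (n : ℝ) ≠ 0 := by exact_mod_cast (by omega : n ≠ 0)
  have hf0 : ((n - 1)! : ℝ) ≠ 0 := by exact_mod_cast Nat.factorial_ne_zero _
  have e : (n ! : ℂ)⁻¹ = (((n ! : ℝ)⁻¹ : ℝ) : ℂ) := by push_cast; rfl
  rw [e, ← Complex.ofReal_mul]
  congr 1
  rw [hfac]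
  field_simp

/-- Floor version of g3's coefficient lemma: the twisted coefficient `(ℓ⁽ⁿ⁾(0)/n!)·Σ_{j<q}(ζ_q^j)^{n+b}` is REAL, and a
one-sided floor `σ λ_n ≥ -m` on the class `q ∣ n + b` gives it the floor `-q·m` (it vanishes off the class). -/
theorem coeff_real_floor {q b n : ℕ} (hq : q ≠ 0) (hn : 1 ≤ n) {dd : ℂ}
    (hdd : dd = ((((n - 1)! : ℝ) * keiperLiCoeff n : ℝ) : ℂ)) {σ m : ℝ} (hm : 0 ≤ m)
    (hlam : q ∣ n + b → -m ≤ σ * keiperLiCoeff n) :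
    ((n ! : ℂ)⁻¹ * dd * ∑ j ∈ Finset.range q, (exp (2 * π * I / q) ^ j) ^ (n + b)).im = 0 ∧
    -((q : ℝ) * m) ≤
      σ * ((n ! : ℂ)⁻¹ * dd * ∑ j ∈ Finset.range q, (exp (2 * π * I / q) ^ j) ^ (n + b)).re := by
  have hqm : 0 ≤ (q : ℝ) * m := mul_nonneg (Nat.cast_nonneg _) hm
  rw [sum_rootOfUnity_pow_mul hq, hdd]
  split_ifs with hdvd
  · have e : ((n ! : ℂ)⁻¹ * ((((n - 1)! : ℝ) * keiperLiCoeff n : ℝ) : ℂ) * (q : ℂ))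
        = (((n ! : ℝ)⁻¹ * (((n - 1)! : ℝ) * keiperLiCoeff n) * (q : ℝ) : ℝ) : ℂ) := by
      push_cast; ring
    rw [e, Complex.ofReal_im, Complex.ofReal_re]
    refine ⟨rfl, ?_⟩
    have hfac : (n ! : ℝ) = n * ((n - 1)! : ℝ) := by
      exact_mod_cast (Nat.mul_factorial_pred (by omega : n ≠ 0)).symm
    have hn0 : (0 : ℝ) < n := by exact_mod_cast (by omega : 0 < n)
    have hf0 : (0 : ℝ) < ((n - 1)! : ℝ) := by exact_mod_cast Nat.factorial_pos _
    have key : σ * ((n ! : ℝ)⁻¹ * (((n - 1)! : ℝ) * keiperLiCoeff n) * (q : ℝ))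
        = (q : ℝ) / n * (σ * keiperLiCoeff n) := by
      rw [hfac]
      field_simp
    rw [key]
    have hqn : (q : ℝ) / n ≤ q := div_le_self (Nat.cast_nonneg _) (by exact_mod_cast hn)
    have hqn0 : 0 ≤ (q : ℝ) / n := by positivity
    have h1 : (q : ℝ) / n * (-m) ≤ (q : ℝ) / n * (σ * keiperLiCoeff n) :=
      mul_le_mul_of_nonneg_left (hlam hdvd) hqn0
    have h2 : (q : ℝ) / n * m ≤ q * m := mul_le_mul_of_nonneg_right hqn hm
    linarith
  · simp only [mul_zero, Complex.zero_im, Complex.zero_re, true_and]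
    linarith

/-! ## 7. A zero of least modulus; EXACT RESONANCE forced by a zero of `φ` and a one-sided floor along `qℕ + a` -/

/-- From any zero of `φ` in the unit disc, a zero of LEAST modulus. -/
theorem exists_least_zero {z₁ : ℂ} (hz₁ : z₁ ∈ Metric.ball (0 : ℂ) 1) (hz₁0 : liPhi z₁ = 0) :
    ∃ z₀ : ℂ, z₀ ∈ Metric.ball (0 : ℂ) 1 ∧ 0 < ‖z₀‖ ∧ liPhi z₀ = 0 ∧
      ∀ z : ℂ, ‖z‖ < ‖z₀‖ → liPhi z ≠ 0 := by
  classical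
  have hz₁n : ‖z₁‖ < 1 := by rwa [Metric.mem_ball, dist_zero_right] at hz₁
  set Z : Set ℂ := Metric.closedBall (0 : ℂ) ‖z₁‖ ∩ liPhi ⁻¹' {0} with hZ
  have hsub : Metric.closedBall (0 : ℂ) ‖z₁‖ ⊆ Metric.ball 0 1 := Metric.closedBall_subset_ball hz₁n
  have hZclosed : IsClosed Z :=
    (differentiableOn_liPhi.continuousOn.mono hsub).preimage_isClosed_of_isClosed
      Metric.isClosed_closedBall isClosed_singleton
  have hZc : IsCompact Z :=
    (isCompact_closedBall (0 : ℂ) ‖z₁‖).of_isClosed_subset hZclosed Set.inter_subset_left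
  have hz₁Z : z₁ ∈ Z := ⟨by rw [Metric.mem_closedBall, dist_zero_right], hz₁0⟩
  obtain ⟨z₀, hz₀Z, hmin⟩ := hZc.exists_isMinOn ⟨z₁, hz₁Z⟩ continuous_norm.continuousOn
  obtain ⟨hz₀cb, hz₀0⟩ := hz₀Z
  replace hz₀0 : liPhi z₀ = 0 := hz₀0
  have hz₀le : ‖z₀‖ ≤ ‖z₁‖ := by rwa [Metric.mem_closedBall, dist_zero_right] at hz₀cb
  have hz₀1 : ‖z₀‖ < 1 := hz₀le.trans_lt hz₁n
  have hz₀ball : z₀ ∈ Metric.ball (0 : ℂ) 1 := by rwa [Metric.mem_ball, dist_zero_right]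
  have hz₀pos : 0 < ‖z₀‖ := by
    rcases (norm_nonneg z₀).eq_or_lt with h | h
    · exfalso
      have : z₀ = 0 := norm_eq_zero.1 h.symm
      rw [this, liPhi_zero] at hz₀0
      norm_num at hz₀0
    · exact h
  have hfree : ∀ z : ℂ, ‖z‖ < ‖z₀‖ → liPhi z ≠ 0 := by
    intro z hz h0
    have hzZ : z ∈ Z := ⟨by rw [Metric.mem_closedBall, dist_zero_right]; linarith, h0⟩
    have := (isMinOn_iff.1 hmin) z hzZ
    linarith
  exact ⟨z₀, hz₀ball, hz₀pos, hz₀0, hfree⟩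

/-- `φ(r) ≠ 0` for real `r` in `[0, 1)` — `ξ > 0` on the real axis (`riemannXi_ofReal_pos`). -/
theorem liPhi_ofReal_ne_zero (r : ℝ) : liPhi ((r : ℝ) : ℂ) ≠ 0 := by
  have e : liMap ((r : ℝ) : ℂ) = (((1 - r)⁻¹ : ℝ) : ℂ) := by
    rw [liMap]
    norm_cast
  intro h0
  have h1 : riemannXi (liMap ((r : ℝ) : ℂ)) = 0 := by simpa [liPhi] using h0
  rw [e] at h1
  exact (riemannXi_ofReal_pos _).ne' h1

/-- The geometric rate `e^ε r₀ < 1` for `ε = -log r₀ / 2`. -/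
theorem exp_eps_mul_lt_one {r₀ : ℝ} (hr₀ : 0 < r₀) (hr₁ : r₀ < 1) :
    0 < -Real.log r₀ / 2 ∧ 0 ≤ Real.exp (-Real.log r₀ / 2) * r₀ ∧
      Real.exp (-Real.log r₀ / 2) * r₀ < 1 := by
  have hlog : Real.log r₀ < 0 := Real.log_neg hr₀ hr₁
  refine ⟨by linarith, by positivity, ?_⟩
  have h1 : Real.exp (-Real.log r₀ / 2) < Real.exp (-Real.log r₀) := Real.exp_lt_exp.2 (by linarith)
  rw [Real.exp_neg, Real.exp_log hr₀] at h1
  calc Real.exp (-Real.log r₀ / 2) * r₀ < r₀⁻¹ * r₀ := mul_lt_mul_of_pos_right h1 hr₀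
    _ = 1 := inv_mul_cancel₀ hr₀.ne'

/-- Summability of the sub-exponential slack `K e^{εn}` against `r₀ⁿ` when `e^ε r₀ < 1`. -/
theorem summable_slack {K ε r₀ : ℝ} (h0 : 0 ≤ Real.exp ε * r₀) (h1 : Real.exp ε * r₀ < 1) :
    Summable fun n : ℕ ↦ K * Real.exp (ε * n) * r₀ ^ n := by
  have e : (fun n : ℕ ↦ K * Real.exp (ε * n) * r₀ ^ n) = fun n : ℕ ↦ K * (Real.exp ε * r₀) ^ n := by
    funext n
    rw [mul_pow, ← Real.exp_nat_mul, mul_comm (n : ℝ) ε, mul_assoc]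
  rw [e]
  exact (summable_geometric_of_lt_one h0 h1).mul_left K

/-- **Resonance from a floor** (scratch `resonance_of_progFloor`, hypothesis `LiProgFloor σ q a` spelled out). If `σ λ_{qk+a} ≥ -C(ε) e^{ε(qk+a)}` for every `ε > 0` and all large `k`,
and Li's `φ` has a zero in the unit disc, then a least-modulus zero `z₀` exists and some rotation `ζ_q^j`
(`j ≠ 0`) carries `z₀` or `|z₀|` onto another zero of `φ`. -/
theorem resonance_of_progFloor {σ : ℝ} (hσ : σ = 1 ∨ σ = -1) {q a : ℕ} (hq : 1 ≤ q)
    (hFloor : ∀ ε : ℝ, 0 < ε → ∃ C : ℝ, ∃ k₀ : ℕ, ∀ k : ℕ, k₀ ≤ k →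
      -C * Real.exp (ε * ((q * k + a : ℕ) : ℝ)) ≤ σ * keiperLiCoeff (q * k + a))
    {z₁ : ℂ} (hz₁ : z₁ ∈ Metric.ball (0 : ℂ) 1) (hz₁0 : liPhi z₁ = 0) :
    ∃ z₀ : ℂ, z₀ ∈ Metric.ball (0 : ℂ) 1 ∧ 0 < ‖z₀‖ ∧ liPhi z₀ = 0 ∧
      (∀ z : ℂ, ‖z‖ < ‖z₀‖ → liPhi z ≠ 0) ∧
      ∃ j ∈ Finset.range q, j ≠ 0 ∧
        (liPhi (exp (2 * π * I / q) ^ j * z₀) = 0 ∨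
          liPhi (exp (2 * π * I / q) ^ j * ((‖z₀‖ : ℝ) : ℂ)) = 0) := by
  have hq0 : q ≠ 0 := by omega
  obtain ⟨z₀, hz₀ball, hz₀pos, hz₀0, hfree⟩ := exists_least_zero hz₁ hz₁0
  have hz₀1 : ‖z₀‖ < 1 := by rwa [Metric.mem_ball, dist_zero_right] at hz₀ball
  refine ⟨z₀, hz₀ball, hz₀pos, hz₀0, hfree, ?_⟩
  by_contra hno
  push Not at hno
  have hfree' : ∀ z ∈ Metric.ball (0 : ℂ) ‖z₀‖, liPhi z ≠ 0 := fun z hz ↦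
    hfree z (by rwa [Metric.mem_ball, dist_zero_right] at hz)
  obtain ⟨ℓ, hℓ, hfl⟩ := exists_log_liPhi hz₀1.le hfree'
  -- the rate
  obtain ⟨hε, hρ0, hρ1⟩ := exp_eps_mul_lt_one hz₀pos hz₀1
  set ε : ℝ := -Real.log ‖z₀‖ / 2 with hεdef
  obtain ⟨C, k₀, hk₀⟩ := hFloor ε hε
  obtain ⟨b, hb⟩ : ∃ b : ℕ, b = a * (q - 1) := ⟨_, rfl⟩
  have hab : q ∣ a + b := ⟨a, by rw [hb]; zify [hq]; ring⟩
  have hζ1 : ‖exp (2 * π * I / q)‖ = 1 := by simpa using norm_rootOfUnity_pow hq0 1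
  have hcsum : ∀ w ∈ Metric.ball (0 : ℂ) ‖z₀‖,
      HasSum (fun n ↦ ((n ! : ℂ)⁻¹ * iteratedDeriv n ℓ 0 *
          ∑ j ∈ Finset.range q, (exp (2 * π * I / q) ^ j) ^ (n + b)) * w ^ n)
        (∑ j ∈ Finset.range q, (exp (2 * π * I / q) ^ j) ^ b *
          ℓ (exp (2 * π * I / q) ^ j * w)) :=
    fun w hw ↦ hasSum_twist hℓ hζ1 q b hw
  -- the slack `d_n = q |C| e^{εn}`
  have hd : ∀ n : ℕ, 0 ≤ (q : ℝ) * (|C| * Real.exp (ε * n)) := fun n ↦ by positivity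
  have hdsum : Summable fun n : ℕ ↦ (q : ℝ) * (|C| * Real.exp (ε * n)) * ‖z₀‖ ^ n := by
    have := (summable_slack (K := |C|) hρ0 hρ1).mul_left (q : ℝ)
    refine this.congr fun n ↦ ?_
    ring
  have hpos : ∀ n, q * k₀ + a + 1 ≤ n →
      ((n ! : ℂ)⁻¹ * iteratedDeriv n ℓ 0 *
          ∑ j ∈ Finset.range q, (exp (2 * π * I / q) ^ j) ^ (n + b)).im = 0 ∧
      -((q : ℝ) * (|C| * Real.exp (ε * n))) ≤ σ * ((n ! : ℂ)⁻¹ * iteratedDeriv n ℓ 0 *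
          ∑ j ∈ Finset.range q, (exp (2 * π * I / q) ^ j) ^ (n + b)).re := by
    intro n hn
    have hn1 : 1 ≤ n := by omega
    refine coeff_real_floor hq0 hn1 (iteratedDeriv_log_eq hz₀pos hℓ hfl hn1) (by positivity)
      fun hdvd ↦ ?_
    obtain ⟨k, hk, rfl⟩ := prog_index (by omega) hab hdvd (by omega : q * k₀ + a ≤ n)
    have h1 := hk₀ k hk
    have h2 : -|C| * Real.exp (ε * ((q * k + a : ℕ) : ℝ)) ≤ -C * Real.exp (ε * ((q * k + a : ℕ) : ℝ)) :=
      mul_le_mul_of_nonneg_right (neg_le_neg (le_abs_self C)) (Real.exp_pos _).le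
    linarith
  refine twisted_core (f := liPhi) hq0 hz₀pos hz₀1 differentiableOn_liPhi hfree' rfl hz₀0 hℓ hfl
    hcsum hd hdsum hσ hpos ?_ ?_
  · intro j hj
    by_cases hj0 : j = 0
    · subst hj0
      rw [pow_zero, one_mul]
      exact liPhi_ofReal_ne_zero _
    · exact (hno j hj hj0).2
  · intro j hj hj0
    exact (hno j hj hj0).1

end Summit.RiemannHypothesis.RiemannHypothesis.Theorems.Splittings.LiOneSidedCriteria

end
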